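import Literature.AnabelianGeometry.AbsoluteAnabelian.SubpadicFiniteExtension
import Literature.AnabelianGeometry.AbsoluteAnabelian.AbsTopIII.KummerFaithfulTrdegInductionProofs
import Mathlib.FieldTheory.RatFunc.Basic
import HarnessLib

/-!
# Finitely generated extensions of (generalized) sub-`p`-adic fields are (generalized) sub-`p`-adic

Proof-only companion to `AbsTopIII/KummerFaithful.lean` and `SubpadicFiniteExtension.lean`
([pGC] = S. Mochizuki, *The local pro-p anabelian geometry of curves*, Invent. Math. 138 (1999),
Def. 15.4 (i) p. 77: a field is sub-`p`-adic if it embeds into a FINITELY GENERATED extension of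
`ℚ_p`; [AbsTopIII] Rmk. 1.5.4 (i)–(ii) pp. 33–34).  By definition the class is closed under finitely
generated extensions — "the function field of a variety over a sub-`p`-adic field is sub-`p`-adic",
the standing reduction of [pGC] §15 / [AbsTopIII] §1 (e.g. Thm. 1.9, Thm. 1.11 for function fields of
curves) — but in the kernel this needs the construction of a finitely generated common extension;
`SubpadicFiniteExtension.exists_fg_extension_of_finite` did the FINITE case.  This file does the
finitely generated case, by the induction on the transcendence degree through curves of
`KummerFaithfulTrdegInductionProofs` (`essFiniteType_curve_induction`): at each step `L` is finite over
`L₀(X)`, `L₀` embeds into a finitely generated `L₁ ⊇ B`, hence `L₀(X) ↪ L₁(X)` (Mathlib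
`RatFunc.mapRingHom`), `L₁(X)` is finitely generated over `B`, and the finite case applies.

* `exists_fg_extension_of_essFiniteType` — the common step, for any base field `B`;
* `IsSubpadicFor.of_essFiniteType` / `IsSubpadic.of_essFiniteType` / `….of_fg` — finitely generated
  extensions of sub-`p`-adic fields are sub-`p`-adic;
* `IsGeneralizedSubpadicFor.of_essFiniteType` — the same for generalized sub-`p`-adic fields ([Tpcs]
  Def. 4.11).

No new definitions; classical field theory. [cite: MochizukiLocAn1999, Def 15.4 (i) p.77]
-/

noncomputable section

open scoped Classical Polynomial

universe u

namespace Literature.AnabelianGeometry.AbsoluteAnabelian.AbsTopIII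

open Polynomial

/-- `F(X) ↪ L(X)` along a field embedding `F ↪ L` (Mathlib `RatFunc.mapRingHom` of
`Polynomial.mapRingHom`). Routine. [cite: MochizukiLocAn1999, Def 15.4 (i) p.77] -/
theorem nonempty_ringHom_ratFunc_of_ringHom {F L : Type*} [Field F] [Field L] (ι : F →+* L) :
    Nonempty (RatFunc F →+* RatFunc L) := by
  refine ⟨RatFunc.mapRingHom (Polynomial.mapRingHom ι) fun q hq => ?_⟩
  rw [Submonoid.mem_comap]
  refine mem_nonZeroDivisors_of_ne_zero ?_
  rw [Polynomial.coe_mapRingHom, Polynomial.map_ne_zero_iff ι.injective]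
  exact nonZeroDivisors.ne_zero hq

/-- The rational function field of a finitely generated extension of `B` is finitely generated over
`B` (`L[X]` is of finite type over `L` and `L(X)` is a localisation of it). Routine.
[cite: MochizukiLocAn1999, Def 15.4 (i) p.77] -/
theorem fg_top_ratFunc {B L : Type*} [Field B] [Field L] [Algebra B L]
    (hL : (⊤ : IntermediateField B L).FG) : (⊤ : IntermediateField B (RatFunc L)).FG := by
  haveI : Algebra.EssFiniteType B L := IntermediateField.fg_top_iff.mp hL
  haveI : Algebra.EssFiniteType L[X] (RatFunc L) :=
    Algebra.EssFiniteType.of_isLocalization _ (nonZeroDivisors L[X])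
  haveI : Algebra.EssFiniteType L L[X] := inferInstance
  haveI : Algebra.EssFiniteType L (RatFunc L) := Algebra.EssFiniteType.comp L L[X] (RatFunc L)
  haveI : Algebra.EssFiniteType B (RatFunc L) := Algebra.EssFiniteType.comp B L (RatFunc L)
  exact IntermediateField.fg_top_iff.mpr inferInstance

/-- **Finitely generated extensions embed into finitely generated extensions**: if `k` maps into a
finitely generated field extension of `B` and `F ⊇ k` is a finitely generated extension
(`Algebra.EssFiniteType k F`), then `F` maps into a finitely generated field extension of `B`.
Induction on the transcendence degree through curves (`essFiniteType_curve_induction`): the finite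
case is `exists_fg_extension_of_finite`, and a finite extension of `L₀(X)` with `L₀ ↪ L₁`, `L₁`
finitely generated over `B`, is finite over the image of `L₀(X) ↪ L₁(X)`, which is finitely generated
over `B`. [cite: MochizukiLocAn1999, Def 15.4 (i) p.77] -/
theorem exists_fg_extension_of_essFiniteType {B : Type} [Field B] {k : Type u} [Field k]
    {F : Type u} [Field F] [Algebra k F] [Algebra.EssFiniteType k F]
    (h : ∃ (L : Type) (_ : Field L) (_ : Algebra B L),
      (⊤ : IntermediateField B L).FG ∧ Nonempty (k →+* L)) :
    ∃ (L' : Type) (_ : Field L') (_ : Algebra B L'),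
      (⊤ : IntermediateField B L').FG ∧ Nonempty (F →+* L') := by
  refine essFiniteType_curve_induction (K₀ := k)
    (fun E _ _ => ∃ (L' : Type) (_ : Field L') (_ : Algebra B L'),
      (⊤ : IntermediateField B L').FG ∧ Nonempty (E →+* L')) ?_ ?_ F
  · -- finite extensions of `k`
    intro E _ _ _
    exact exists_fg_extension_of_finite h
  · -- finite extensions of `L₀(X)`, `L₀` finitely generated over `k`
    intro L₀ _ _ _ ih L _ _ _ _ _ _ _ _ _ _ _
    -- `L₀` itself embeds into a finitely generated extension `L₁` of `B`
    obtain ⟨L₁, _, _, hL₁, ⟨ι₀⟩⟩ := ih L₀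
    -- hence `L₀(X) ↪ L₁(X)`, finitely generated over `B`; `L` is finite over `L₀(X)`
    obtain ⟨ιX⟩ := nonempty_ringHom_ratFunc_of_ringHom ι₀
    haveI : Module.Finite (RatFunc L₀) L := inferInstance
    exact exists_fg_extension_of_finite (k := RatFunc L₀) (F := L)
      ⟨RatFunc L₁, inferInstance, _, fg_top_ratFunc hL₁, ⟨ιX⟩⟩

/-- **A finitely generated extension of a sub-`p`-adic field is sub-`p`-adic** ([pGC] Def. 15.4 (i):
function fields of varieties over sub-`p`-adic fields; the standing reduction of [AbsTopIII] §1).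
[cite: MochizukiLocAn1999, Def 15.4 (i) p.77] -/
theorem IsSubpadicFor.of_essFiniteType {k : Type u} [Field k] {F : Type u} [Field F] [Algebra k F]
    [Algebra.EssFiniteType k F] {p : ℕ} [Fact p.Prime] (h : IsSubpadicFor k p) :
    IsSubpadicFor F p :=
  ⟨exists_fg_extension_of_essFiniteType h.exists_embedding⟩

/-- A finitely generated extension (`(⊤ : IntermediateField k F).FG`) of a sub-`p`-adic field is
sub-`p`-adic. [cite: MochizukiLocAn1999, Def 15.4 (i) p.77] -/
theorem IsSubpadicFor.of_fg {k : Type u} [Field k] {F : Type u} [Field F] [Algebra k F]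
    (hF : (⊤ : IntermediateField k F).FG) {p : ℕ} [Fact p.Prime] (h : IsSubpadicFor k p) :
    IsSubpadicFor F p := by
  haveI : Algebra.EssFiniteType k F := IntermediateField.fg_top_iff.mp hF
  exact h.of_essFiniteType

/-- A finitely generated extension of a sub-`p`-adic field is sub-`p`-adic (prime-free form).
[cite: MochizukiLocAn1999, Def 15.4 (i) p.77] -/
theorem IsSubpadic.of_essFiniteType {k : Type u} [Field k] {F : Type u} [Field F] [Algebra k F]
    [Algebra.EssFiniteType k F] (h : IsSubpadic k) : IsSubpadic F := by
  obtain ⟨p, hp, hk⟩ := h.exists_prime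
  exact ⟨⟨p, hp, hk.of_essFiniteType⟩⟩

/-- A finitely generated extension (`(⊤ : IntermediateField k F).FG`) of a sub-`p`-adic field is
sub-`p`-adic (prime-free form). [cite: MochizukiLocAn1999, Def 15.4 (i) p.77] -/
theorem IsSubpadic.of_fg {k : Type u} [Field k] {F : Type u} [Field F] [Algebra k F]
    (hF : (⊤ : IntermediateField k F).FG) (h : IsSubpadic k) : IsSubpadic F := by
  haveI : Algebra.EssFiniteType k F := IntermediateField.fg_top_iff.mp hF
  exact h.of_essFiniteType

/-- A finitely generated extension of a generalized sub-`p`-adic field is generalized sub-`p`-adic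
([Tpcs] Def. 4.11 p. 44). [cite: MochizukiTopics2003, Def 4.11 p.44] -/
theorem IsGeneralizedSubpadicFor.of_essFiniteType {k : Type u} [Field k] {F : Type u} [Field F]
    [Algebra k F] [Algebra.EssFiniteType k F] {p : ℕ} [Fact p.Prime]
    (h : IsGeneralizedSubpadicFor k p) : IsGeneralizedSubpadicFor F p :=
  ⟨exists_fg_extension_of_essFiniteType h.exists_embedding⟩

end Literature.AnabelianGeometry.AbsoluteAnabelian.AbsTopIII

end
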